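import Summits.ABC.StewartYu.PadicTwistFinal
import HarnessLib

/-!
# The Waldschmidt-shape engine at `p ≡ 3 (mod 4)` with its constant WRITTEN OUT (papers lane ABC-P1, writer seat; theorems only)

`Summits/ABC/ABC/Theorems/AbcExplicitW80EngineThreeModFour.lean`.  The cell's engine
`Summit.ABC.StewartYu.TwistSetup.engineThreeModFourW80` (`PadicTwistFinal.lean`) is the `∃ (C) (c₁)`-packaging, by
`engineW80_of_coreBound` (`PadicTwistEngine.lean`), of the landed core bound `twistCoreBound_holds :
TwistCoreBound (fun m => 2 * PadicW80Par.Cw m)`; the witnesses of the packaging are `C m = 2·Cw m` (`m ≥ 1`) and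
`c₁ = 2^70`, but they are not visible in the `∃`-statement.  This file re-runs the reduction
`engineW80_of_coreBound` VERBATIM with the existential opened:

* `TwistSetup.engineW80_of_coreBound_explicit` — for any admissible `C` (`2 ≤ C m` for `m ≥ 1`) with `TwistCoreBound C`,
  the engine text at `p ≡ 3 (mod 4)` with the constant `C m` itself (the body of `engineW80_of_coreBound`, unchanged:
  signs and odd-order roots `ηᵢ`, a coefficient of minimal `p`-adic order, the sign of the twisted product, `‖Λ‖ =
  ‖b_θ‖‖Λ₀‖`, class price `G = (p−1)/2 < p/2`);
* `TwistSetup.engineThreeModFourW80_explicit` — the engine with `C m = 2·Cw m = 2(2⁶⁹m)^m` in the statement.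

No new definition; [folklore] bookkeeping on landed theorems.  WHAT THIS IS NOT: no new estimate — the analytic
core is `twistCoreBound_holds`, used by name. [cite: Yu1990, Theorem 2.1] [cite: Waldschmidt1980, §3.6 (p. 275)]
-/

noncomputable section

open NormedSpace Finset IsUltrametricDist Height
open Literature.NumberTheory.Transcendental
open Literature.NumberTheory.Transcendental.PadicCW77 (reidxEquiv reidxEquiv_castSucc reidxEquiv_last
  snoc_comp_succAbove one_div_le_norm_intCast)
open scoped Nat

namespace Summit.ABC.StewartYu

namespace TwistSetup

/-- **The W80-shape engine at `p ≡ 3 (mod 4)` from the core bound, constant in the statement**: for an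
admissible `C` (`2 ≤ C m` for `m ≥ 1`) with `TwistCoreBound C`, at every prime `p ≡ 3 (mod 4)`, for rational
`p`-adic units `α₁, …, α_m` (multiplicatively independent, no signed sub-product a square), heights `h(αⱼ) ≤ Vⱼ`,
floors `log p ≤ Vⱼ ≤ Vmax`, `b ≠ 0`, `log max(3,|bⱼ|) ≤ W`, `log p ≤ W`:
`ord_p(∏ αⱼ^{bⱼ} − 1) ≤ C(m) · p · ∏(Vⱼ/log p) · (W + log 2Vmax) · log(2Vmax)` — the body of
`engineW80_of_coreBound` verbatim, without the `∃ (C) (c₁)` packaging (for `m = 0` the hypothesis `b ≠ 0` is absurd).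
[cite: Yu1990, Theorem 2.1] [cite: Waldschmidt1980, §3.6 (p. 275)] -/
theorem engineW80_of_coreBound_explicit {C : ℕ → ℝ} (hC2 : ∀ m, 1 ≤ m → 2 ≤ C m) (hcore : TwistCoreBound C) :
    ∀ (p : ℕ), p.Prime → p % 4 = 3 → ∀ (m : ℕ) (α : Fin m → ℚ) (b : Fin m → ℤ) (V : Fin m → ℝ)
      (Vmax W : ℝ),
      (∀ j, α j ≠ 0 ∧ padicValRat p (α j) = 0) →
      (∀ μ : Fin m → ℤ, ∏ j, α j ^ μ j = 1 → μ = 0) →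
      (∀ T : Finset (Fin m), T.Nonempty → ¬ IsSquare (∏ j ∈ T, α j) ∧ ¬ IsSquare (-∏ j ∈ T, α j)) →
      (∀ j, Height.logHeight₁ (α j) ≤ V j) → (∀ j, Real.log p ≤ V j) → (∀ j, V j ≤ Vmax) →
      b ≠ 0 → (∀ j, Real.log (max 3 (|b j| : ℝ)) ≤ W) → Real.log p ≤ W →
      (padicValRat p (∏ j, α j ^ b j - 1) : ℝ) ≤
        C m * p * (∏ j, V j / Real.log p) * (W + Real.log (2 * Vmax)) * Real.log (2 * Vmax) := by
  classical
  intro p hp hp4 m α b V Vmax W hα hmult hK hV hVp hVmax hb hW hWp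
  haveI : Fact p.Prime := ⟨hp⟩
  have hp3 : 3 ≤ p := by have := hp.two_le; omega
  -- `m = d + 1`
  obtain ⟨d, rfl⟩ : ∃ d, m = d + 1 := by
    rcases m with - | d
    · exact absurd (Subsingleton.elim b 0) hb
    · exact ⟨d, rfl⟩
  -- positivity bookkeeping for the right-hand side
  have hlp : 1 < Real.log p := by
    rw [← Real.exp_lt_exp, Real.exp_log (by exact_mod_cast hp.pos)]
    refine lt_of_lt_of_le ?_ (by exact_mod_cast hp3 : (3 : ℝ) ≤ p)
    have := Real.exp_one_lt_d9; norm_num at this ⊢; linarith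
  have hlp0 : 0 < Real.log p := by linarith
  have hVpos : ∀ i, 0 < V i := fun i => hlp0.trans_le (hVp i)
  have hVl1 : ∀ i, 1 ≤ V i / Real.log p := fun i => by rw [le_div_iff₀ hlp0, one_mul]; exact hVp i
  have hprod1 : 1 ≤ ∏ i, V i / Real.log p := by
    calc (1 : ℝ) = ∏ _i : Fin (d + 1), (1 : ℝ) := by simp
      _ ≤ ∏ i, V i / Real.log p := prod_le_prod (fun _ _ => zero_le_one) fun i _ => hVl1 i
  have hlog3 : 1 < Real.log 3 := by
    rw [Real.lt_log_iff_exp_lt (by norm_num)]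
    have := Real.exp_one_lt_d9; linarith
  obtain ⟨j₀⟩ : Nonempty (Fin (d + 1)) := ⟨0⟩
  have hVmax3 : Real.log 3 ≤ Vmax := by
    calc Real.log 3 ≤ Real.log p := Real.log_le_log (by norm_num) (by exact_mod_cast hp3)
      _ ≤ V j₀ := hVp j₀
      _ ≤ Vmax := hVmax j₀
  have hl2V : Real.log 2 ≤ Real.log (2 * Vmax) := Real.log_le_log two_pos (by linarith)
  have hl2V0 : 0 < Real.log (2 * Vmax) := lt_of_lt_of_le (Real.log_pos one_lt_two) hl2V
  have hl2 : (1 : ℝ) / 2 < Real.log 2 := by have := Real.log_two_gt_d9; linarith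
  have hW3 : Real.log 3 ≤ W := le_trans (Real.log_le_log (by norm_num) (le_max_left _ _)) (hW j₀)
  have hW0 : 0 < W := by linarith
  have hC0 : 0 ≤ C (d + 1) := by linarith [hC2 (d + 1) d.succ_pos]
  have hp0 : (0 : ℝ) < p := by exact_mod_cast hp.pos
  have hRHS0 : 0 ≤ C (d + 1) * p * (∏ j, V j / Real.log p) * (W + Real.log (2 * Vmax)) * Real.log (2 * Vmax) := by
    have : 0 ≤ W + Real.log (2 * Vmax) := by linarith
    positivity
  -- the trivial case `ord_p(Θ₀ − 1) ≤ 0`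
  set Θ₀ : ℚ := ∏ j, α j ^ b j with hΘ₀
  by_cases hv : padicValRat p (Θ₀ - 1) < 1
  · have : (padicValRat p (Θ₀ - 1) : ℝ) ≤ 0 := by exact_mod_cast (show padicValRat p (Θ₀ - 1) ≤ 0 by omega)
    exact this.trans hRHS0
  push Not at hv
  have hΘ₀1 : Θ₀ - 1 ≠ 0 := by
    intro h0; rw [h0, padicValRat.zero] at hv; exact absurd hv (by norm_num)
  have hΘ₀ne : Θ₀ ≠ 0 := prod_ne_zero_iff.mpr fun j _ => zpow_ne_zero _ (hα j).1
  have hnormΘ : ‖((Θ₀ - 1 : ℚ) : ℚ_[p])‖ = (p : ℝ) ^ (-padicValRat p (Θ₀ - 1)) := by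
    rw [Padic.norm_eq_zpow_neg_valuation (by exact_mod_cast hΘ₀1), Padic.valuation_ratCast]
  have hprinΘ : ‖(Θ₀ : ℚ_[p]) - 1‖ ≤ (p : ℝ)⁻¹ := by
    have e : (Θ₀ : ℚ_[p]) - 1 = ((Θ₀ - 1 : ℚ) : ℚ_[p]) := by push_cast; ring
    rw [e, hnormΘ, ← zpow_neg_one]
    exact zpow_le_zpow_right₀ (by exact_mod_cast hp.one_lt.le) (by linarith)
  -- an index with `b ≠ 0` of minimal `p`-adic order
  set I : Finset (Fin (d + 1)) := univ.filter fun i => b i ≠ 0 with hI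
  have hIne : I.Nonempty := by
    by_contra hne
    rw [Finset.not_nonempty_iff_eq_empty] at hne
    apply hb; funext i
    by_contra hbi
    have : i ∈ I := by rw [hI, mem_filter]; exact ⟨mem_univ _, hbi⟩
    rw [hne] at this; simp at this
  obtain ⟨i₀, hi₀I, hmin⟩ := I.exists_min_image (fun i => padicValInt p (b i)) hIne
  have hbi₀ : b i₀ ≠ 0 := by rw [hI, mem_filter] at hi₀I; exact hi₀I.2
  -- the twist
  obtain ⟨σ, η, hσ, hηG, hprin⟩ := twist_exists_family hp4 α hα
  set α' : Fin (d + 1) → ℚ := fun i => (σ i : ℚ) * α i with hα'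
  have hσne : ∀ i, (σ i : ℚ) ≠ 0 := fun i => by rcases hσ i with h | h <;> rw [h] <;> norm_num
  have hα'ne : ∀ i, α' i ≠ 0 := fun i => mul_ne_zero (hσne i) (hα i).1
  -- the set-up
  let S : TwistSetup p :=
    { hp3 := hp3, d := d, α := fun j => α' (i₀.succAbove j), θ := α' i₀,
      α_ne := fun j => hα'ne _, θ_ne := hα'ne _,
      b := fun j => b (i₀.succAbove j), bθ := b i₀, bθ_ne := hbi₀,
      hbmin := fun j hj => hmin _ (by rw [hI, mem_filter]; exact ⟨mem_univ _, hj⟩),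
      G := (p - 1) / 2, hG := (odd_half_sub_one hp4).pos,
      η := fun i => η (reidxEquiv i₀ i), hηG := fun i => hηG _,
      hprin := fun i => by
        have e : ((Fin.snoc (α := fun _ => ℚ) (fun j => α' (i₀.succAbove j)) (α' i₀) : Fin (d + 1) → ℚ) i
            : ℚ_[p]) = ((((σ (reidxEquiv i₀ i) : ℚ) * α (reidxEquiv i₀ i) : ℚ)) : ℚ_[p]) := by
          rw [snoc_comp_succAbove α' i₀ i]
        rw [e]; exact hprin _ }
  -- `S.toQ.all = α' ∘ e`
  have hall : ∀ i, S.toQ.all i = α' (reidxEquiv i₀ i) := fun i => snoc_comp_succAbove α' i₀ i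
  -- transport the Kummer condition
  have hK' : ∀ T : Finset (Fin (S.d + 1)), T.Nonempty → ¬ IsSquare (∏ i ∈ T, S.toQ.all i) := by
    intro T hT
    have e1 : ∏ i ∈ T, S.toQ.all i = ∏ j ∈ T.map (reidxEquiv i₀).toEmbedding, α' j := by
      rw [Finset.prod_map]; exact prod_congr rfl fun i _ => hall i
    rw [e1]
    exact not_isSquare_prod_sign_mul α σ hσ hK _ (by simpa using hT)
  -- transport the multiplicative independence
  have hmult' : ∀ μ : Fin (S.d + 1) → ℤ, ∏ i, S.toQ.all i ^ μ i = 1 → μ = 0 := by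
    intro μ hμ
    have e1 : ∏ i, S.toQ.all i ^ μ i = ∏ j, α' j ^ μ ((reidxEquiv i₀).symm j) := by
      rw [← (reidxEquiv i₀).prod_comp (fun j => α' j ^ μ ((reidxEquiv i₀).symm j))]
      exact prod_congr rfl fun i _ => by rw [hall, Equiv.symm_apply_apply]
    rw [e1] at hμ
    have h0 := indep_sign_mul α σ hσ hmult _ hμ
    funext i
    have := congrFun h0 (reidxEquiv i₀ i)
    simpa using this
  -- heights of signed generators
  have hh' : ∀ i, logHeight₁ (α' i) = logHeight₁ (α i) := by
    intro i; simp only [hα']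
    rcases hσ i with h | h
    · rw [h]; simp
    · rw [h]; push_cast; rw [neg_one_mul, logHeight₁_neg]
  -- the core bound
  have hΛ₀ := hcore p S (fun j => V (i₀.succAbove j)) (V i₀) Vmax W (odd_half_sub_one hp4)
    (show (p - 1) / 2 ≤ p by omega) hK' hmult'
    (fun j => by change logHeight₁ (α' _) ≤ _; rw [hh']; exact hV _)
    (by change logHeight₁ (α' _) ≤ _; rw [hh']; exact hV _)
    (fun j => hVp _) (hVp i₀) (fun j => hVmax _) (hVmax i₀) (fun j => hW _) (hW i₀) hWp
  -- `(∏ⱼ V(succAbove j)/ℓ) · V i₀/ℓ = ∏ᵢ Vᵢ/ℓ`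
  have hprodV : (∏ j : Fin d, V (i₀.succAbove j) / Real.log p) * (V i₀ / Real.log p) =
      ∏ i, V i / Real.log p := by
    rw [Fin.prod_univ_succAbove (fun i => V i / Real.log p) i₀, mul_comm]
  set U : ℝ := C (d + 1) * ((p - 1) / 2 : ℕ) * (∏ i, V i / Real.log p) * (W + Real.log (2 * Vmax)) *
    Real.log (2 * Vmax) with hU
  have hΛ₀' : Real.exp (-U) < ‖S.Λ₀‖ := by
    have : C (S.d + 1) * S.G * ((∏ j : Fin S.d, V (i₀.succAbove j) / Real.log p) * (V i₀ / Real.log p)) *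
        (W + Real.log (2 * Vmax)) * Real.log (2 * Vmax) = U := by
      rw [hU]
      change C (d + 1) * (((p - 1) / 2 : ℕ) : ℝ) *
        ((∏ j : Fin d, V (i₀.succAbove j) / Real.log p) * (V i₀ / Real.log p)) * _ * _ = _
      rw [hprodV]
    rw [this] at hΛ₀; exact hΛ₀
  have hG1 : (1 : ℝ) ≤ (((p - 1) / 2 : ℕ) : ℝ) := by
    exact_mod_cast (show 1 ≤ (p - 1) / 2 by omega)
  have hGp : (((p - 1) / 2 : ℕ) : ℝ) ≤ (p : ℝ) / 2 := by
    have h1 : (((p - 1) / 2 : ℕ) : ℝ) ≤ ((p - 1 : ℕ) : ℝ) / 2 := Nat.cast_div_le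
    have h2 : ((p - 1 : ℕ) : ℝ) ≤ p := by exact_mod_cast Nat.sub_le p 1
    linarith
  have hU0 : 0 ≤ U := by
    rw [hU]
    have : 0 ≤ W + Real.log (2 * Vmax) := by linarith
    positivity
  -- `W ≤ U`
  have hWU : W ≤ U := by
    rw [hU]
    have hC2' := hC2 (d + 1) d.succ_pos
    have h1 : W ≤ C (d + 1) * (W + Real.log (2 * Vmax)) * Real.log (2 * Vmax) := by
      calc W = 2 * W * (1 / 2) := by ring
        _ ≤ C (d + 1) * (W + Real.log (2 * Vmax)) * Real.log (2 * Vmax) := by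
            refine mul_le_mul (mul_le_mul hC2' (by linarith) hW0.le (by linarith)) (by linarith)
              (by norm_num) (by positivity)
    calc W ≤ C (d + 1) * (W + Real.log (2 * Vmax)) * Real.log (2 * Vmax) := h1
      _ = C (d + 1) * 1 * 1 * (W + Real.log (2 * Vmax)) * Real.log (2 * Vmax) := by ring
      _ ≤ C (d + 1) * (((p - 1) / 2 : ℕ) : ℝ) * (∏ i, V i / Real.log p) * (W + Real.log (2 * Vmax)) *
            Real.log (2 * Vmax) := by
          have : 0 ≤ W + Real.log (2 * Vmax) := by linarith
          gcongr
  -- `S.Θ = ε · Θ₀` with a sign `ε`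
  have hΘ : S.Θ = (∏ i, (σ i : ℚ) ^ b i) * Θ₀ := by
    change (∏ j : Fin d, α' (i₀.succAbove j) ^ b (i₀.succAbove j)) * α' i₀ ^ b i₀ = _
    rw [hΘ₀, ← prod_mul_distrib, Fin.prod_univ_succAbove (fun i => (σ i : ℚ) ^ b i * α i ^ b i) i₀,
      mul_comm]
    congr 1
    · simp only [hα', mul_zpow]
    · exact prod_congr rfl fun j _ => by simp only [hα', mul_zpow]
  -- the sign is `+1`: otherwise `−ρ_b` would be a principal unit with `(−ρ_b)^G = −1`
  have hε : (∏ i, (σ i : ℚ) ^ b i) = 1 := by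
    rcases prod_sign_eq univ σ hσ b with h1 | hneg
    · exact h1
    · exfalso
      -- `Ω = S.Θ · ρ_b = −Θ₀ ρ_b` is principal and so is `Θ₀`; hence `x := −ρ_b` is principal
      have hΩ : ‖1 - (S.Θ : ℚ_[p]) * S.ηb‖ ≤ (p : ℝ)⁻¹ := by
        rw [← S.prod_ω_zpow_eq]; exact S.norm_one_sub_prod_ω_zpow_le
      have hΘ₀p : ‖1 - (Θ₀ : ℚ_[p])‖ ≤ (p : ℝ)⁻¹ := by rwa [norm_sub_rev] at hprinΘ
      have hΘ₀p' : (Θ₀ : ℚ_[p]) ≠ 0 := by exact_mod_cast hΘ₀ne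
      have hx : ‖1 - (-S.ηb)‖ ≤ (p : ℝ)⁻¹ := by
        have e : -S.ηb = ((S.Θ : ℚ_[p]) * S.ηb) * (Θ₀ : ℚ_[p])⁻¹ := by
          rw [hΘ, hneg]; push_cast; field_simp
        rw [e]
        exact PadicExp.norm_one_sub_mul_le S.inv_p_lt_one hΩ
          (PadicExp.norm_one_sub_inv_le S.inv_p_lt_one hΘ₀p)
      have hxG : (-S.ηb) ^ S.G = -1 := by
        rw [neg_pow, S.ηb_pow_G, (odd_half_sub_one hp4).neg_one_pow]; norm_num
      -- a principal unit has principal powers: `‖1 − x^G‖ ≤ p⁻¹ < 1 = ‖1 − (−1)‖ = ‖2‖`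
      have hpow : ‖1 - (-S.ηb) ^ S.G‖ ≤ (p : ℝ)⁻¹ := by
        have := PadicExp.norm_one_sub_zpow_le S.inv_p_nonneg S.inv_p_lt_one hx (S.G : ℤ)
        rwa [zpow_natCast] at this
      rw [hxG, sub_neg_eq_add, one_add_one_eq_two, PadicExp.norm_two_eq_one S.hp3] at hpow
      exact absurd hpow (not_le.mpr S.inv_p_lt_one)
  have hΘ' : S.Θ = Θ₀ := by rw [hΘ, hε, one_mul]
  -- `‖Λ‖ = ‖Θ₀ − 1‖_p = ‖b_θ‖ ‖Λ₀‖ > e^{−W} e^{−U}`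
  have hnorm' : ‖((Θ₀ - 1 : ℚ) : ℚ_[p])‖ = ‖(S.bθ : ℚ_[p])‖ * ‖S.Λ₀‖ := by
    rw [← S.norm_Λ_eq_mul, S.norm_Λ_of_principal (by rw [hΘ']; exact hprinΘ), hΘ']; push_cast; rfl
  have hbθ : Real.exp (-W) ≤ ‖(S.bθ : ℚ_[p])‖ := by
    change Real.exp (-W) ≤ ‖((b i₀ : ℤ) : ℚ_[p])‖
    have habs0 : 0 < |(b i₀ : ℝ)| := abs_pos.mpr (by exact_mod_cast hbi₀)
    have h1 : (1 : ℝ) / |(b i₀ : ℝ)| ≤ ‖((b i₀ : ℤ) : ℚ_[p])‖ := one_div_le_norm_intCast hbi₀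
    have hle : |(b i₀ : ℝ)| ≤ Real.exp W := by
      have hlogb : Real.log |(b i₀ : ℝ)| ≤ W :=
        (Real.log_le_log habs0 (le_max_right _ _)).trans (hW i₀)
      calc |(b i₀ : ℝ)| = Real.exp (Real.log |(b i₀ : ℝ)|) := (Real.exp_log habs0).symm
        _ ≤ Real.exp W := Real.exp_le_exp.mpr hlogb
    calc Real.exp (-W) = 1 / Real.exp W := by rw [Real.exp_neg, one_div]
      _ ≤ 1 / |(b i₀ : ℝ)| := one_div_le_one_div_of_le habs0 hle
      _ ≤ ‖((b i₀ : ℤ) : ℚ_[p])‖ := h1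
  have hkey : Real.exp (-(U + W)) < (p : ℝ) ^ (-padicValRat p (Θ₀ - 1)) := by
    rw [← hnormΘ, hnorm', show -(U + W) = -W + -U by ring, Real.exp_add]
    exact mul_lt_mul' hbθ hΛ₀' (Real.exp_pos _).le (lt_of_lt_of_le (Real.exp_pos _) hbθ)
  -- take logarithms: `v log p < U + W ≤ 2U`, and `2U/log p ≤ C p ∏(V/log p) (W + L) L`
  have hlog := Real.log_lt_log (Real.exp_pos _) hkey
  rw [Real.log_exp, Real.log_zpow] at hlog
  push_cast at hlog
  -- `v · log p ≤ 2U`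
  have hv2 : (padicValRat p (Θ₀ - 1) : ℝ) * Real.log p ≤ 2 * U := by nlinarith [hlog, hWU]
  -- `2U ≤ log p · RHS`
  have h2U : 2 * U ≤ Real.log p *
      (C (d + 1) * p * (∏ j, V j / Real.log p) * (W + Real.log (2 * Vmax)) * Real.log (2 * Vmax)) := by
    rw [hU]
    have hWL : 0 ≤ W + Real.log (2 * Vmax) := by linarith
    have hGp' : 2 * (((p - 1) / 2 : ℕ) : ℝ) ≤ Real.log p * p := by
      calc 2 * (((p - 1) / 2 : ℕ) : ℝ) ≤ p := by linarith
        _ = 1 * p := (one_mul _).symm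
        _ ≤ Real.log p * p := mul_le_mul_of_nonneg_right hlp.le hp0.le
    calc 2 * (C (d + 1) * (((p - 1) / 2 : ℕ) : ℝ) * (∏ i, V i / Real.log p) * (W + Real.log (2 * Vmax)) *
          Real.log (2 * Vmax))
        = (2 * (((p - 1) / 2 : ℕ) : ℝ)) * (C (d + 1) * (∏ i, V i / Real.log p) * (W + Real.log (2 * Vmax)) *
          Real.log (2 * Vmax)) := by ring
      _ ≤ (Real.log p * p) * (C (d + 1) * (∏ i, V i / Real.log p) * (W + Real.log (2 * Vmax)) *
          Real.log (2 * Vmax)) := mul_le_mul_of_nonneg_right hGp' (by positivity)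
      _ = _ := by ring
  have hfin := hv2.trans h2U
  rw [mul_comm (Real.log p)] at hfin
  exact le_of_mul_le_mul_right hfin hlp0

/-- **THE ENGINE at `p ≡ 3 (mod 4)` with its constant written out**: `C(m) = 2·Cw(m) = 2(2⁶⁹m)^m` in the statement
(`engineThreeModFourW80` is its `∃ (C) (c₁)`-packaging with `c₁ = 2^70`). [cite: Yu1990, Theorem 2.1]
[cite: Waldschmidt1980, §3.6 (p. 275)] -/
theorem engineThreeModFourW80_explicit :
    ∀ (p : ℕ), p.Prime → p % 4 = 3 → ∀ (m : ℕ) (α : Fin m → ℚ) (b : Fin m → ℤ) (V : Fin m → ℝ)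
      (Vmax W : ℝ),
      (∀ j, α j ≠ 0 ∧ padicValRat p (α j) = 0) →
      (∀ μ : Fin m → ℤ, ∏ j, α j ^ μ j = 1 → μ = 0) →
      (∀ T : Finset (Fin m), T.Nonempty → ¬ IsSquare (∏ j ∈ T, α j) ∧ ¬ IsSquare (-∏ j ∈ T, α j)) →
      (∀ j, Height.logHeight₁ (α j) ≤ V j) → (∀ j, Real.log p ≤ V j) → (∀ j, V j ≤ Vmax) →
      b ≠ 0 → (∀ j, Real.log (max 3 (|b j| : ℝ)) ≤ W) → Real.log p ≤ W →
      (padicValRat p (∏ j, α j ^ b j - 1) : ℝ) ≤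
        2 * PadicW80Par.Cw m * p * (∏ j, V j / Real.log p) * (W + Real.log (2 * Vmax)) * Real.log (2 * Vmax) :=
  engineW80_of_coreBound_explicit (C := fun m => 2 * PadicW80Par.Cw m)
    (fun m hm => by have := PadicW80Par.two_le_Cw hm; change 2 ≤ 2 * PadicW80Par.Cw m; linarith)
    twistCoreBound_holds

end TwistSetup

end Summit.ABC.StewartYu

end
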